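import Mathlib
import Summits.QuantumFields.YangMills.Theorems.ConvexGribovBodyContinuumLegGivenGapCsclTorusForms
import Summits.QuantumFields.YangMills.Theorems.ConvexGribovBodyContinuumLegGivenGapStubObsGeometry
import HarnessLib

/-!
# `ContinuumLegGivenGap` (stmt-QuantumFields-15828), line `Sketch`, reshape 18: `stub_csclTorusRP` — the complex two-form reflection-positivity package of the odd torus

Support file for the crux item stmt-QuantumFields-15828 (registered glue stub `stub_csclTorusRP` of line `Sketch`, reshape 18).

On the torus of side `2S+1` at `β ≥ 0`, write `Ũ = torusLift (2S+1) U`, `Θ = gaugeTimeReflect` (bond reflection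
`x₀ ↦ -1-x₀`), `τᶜ = configShift (−c e₀)` and, for bounded measurable complex observables `X, Y` of the `ℤ⁴` gauge field,
`B_s(X,Y) = ∫ conj X(ΘŨ) · Y(τˢŨ) dμ`; the site-reflection pairing of the crux line is
`𝒫_σ(X,Y) = ∫ conj X(cfgReflect Ũ) · Y(τ^σ Ũ) dμ = B_{σ-1}(X,Y)` (`cscl_site_pairing_eq`).

* `csclRP_cs_of_herm`: for a fixed shift `s`, Hermitian symmetry of `B_s` on the pair `(X,Y)` and positivity of
  `Re B_s(X + cY, X + cY)` for all complex `c` give the Cauchy–Schwarz inequality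
  `‖B_s(X,Y)‖² ≤ Re B_s(X,X) · Re B_s(Y,Y)` (`cscl_form_expand` + `cscl_cs_of_psd`).
* `csclRP_site` / `csclRP_bond`: the site form `B_1` (resp. the bond form `B_0`) on bounded measurable cylinder
  observables supported at times `0 ≤ x₀`, `maxTime + 2 ≤ S` (resp. `maxTime + 1 ≤ S`) has real non-negative diagonal
  and satisfies Cauchy–Schwarz: positivity is the tree's `torus_rp_site` / `torus_rp_bond`
  (`CriticalContinuumLimit.AdmissibleGap`) applied to `X + cY`, Hermitian symmetry is `cscl_site_herm` / `cscl_bond_herm`.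
* `csclRP_shift_obs`: the time translate `X ∘ τ^{k-1}` of an observable supported at times `1 ≤ x₀ ≤ v` is a bounded
  measurable cylinder observable supported at times `k ≤ x₀ ≤ v+k-1`.
* `csclRP_dict_site` / `csclRP_dict_bond` (the dictionary): `𝒫_{k+l}(X,Y) = B_1(X∘τ^{k-1}, Y∘τ^{l-1})` and
  `𝒫_{k+l-1}(X,Y) = B_0(X∘τ^{k-1}, Y∘τ^{l-1})` (`cscl_site_pairing_eq`, `cscl_shift_pair`).
* `stub_csclTorusRP`: hence `σ ↦ 𝒫_σ(X,X)` is real, non-negative and log-convex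
  (`‖𝒫_{σ+1}‖² ≤ Re 𝒫_σ · Re 𝒫_{σ+2}`, parity split: even `σ` through the site form, odd `σ` through the bond form), and
  `‖𝒫_{a+c}(X,Y)‖² ≤ Re 𝒫_{2a}(X,X) · Re 𝒫_{2c}(Y,Y)` (site form on `X∘τ^{a-1}`, `Y∘τ^{c-1}`).

References: K. Osterwalder, E. Seiler, Ann. Phys. 110 (1978) 440, §2; J. Glimm, A. Jaffe, *Quantum Physics* (1987) §6.1.
No definitions, no facts; Mathlib + landed tree lemmas only. [folklore]
-/

noncomputable section

namespace Summit.QuantumFields.YangMills.Theorems.ContinuumLegGivenGap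

open scoped SchwartzMap ComplexConjugate
open Filter Topology MeasureTheory
open Literature.MathematicalPhysics.QuantumFieldTheory Literature.MathematicalPhysics.QuantumLattice
  Literature.MathematicalPhysics.AQFT Literature.Probability.LatticeModels
open Summit.QuantumFields.YangMills.Theorems.CriticalContinuumLimit.AdmissibleGap
  (maxTime torus_rp_bond torus_rp_site)
open Summit.QuantumFields.YangMills.Theorems.ClusteringToYangMills.Reconstructible

/-! ### Abstract layer: Cauchy–Schwarz for a Hermitian positive form `B_s` -/

/-- Real part of the sesquilinear expansion of a Hermitian datum:
`Re (bXX + c bXY + c̄ · conj bXY + c̄ c bYY) = Re bXX + 2 Re (c bXY) + |c|² Re bYY`. [folklore] -/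
theorem csclRP_re_expand (bXX bXY bYY c : ℂ) :
    (bXX + c * bXY + conj c * conj bXY + conj c * c * bYY).re =
      bXX.re + 2 * (c * bXY).re + ‖c‖ ^ 2 * bYY.re := by
  rw [← map_mul, Complex.conj_mul', ← Complex.ofReal_pow]
  simp only [Complex.add_re, Complex.conj_re, Complex.re_ofReal_mul]
  ring

section Forms

variable {G : Type} [Group G] [TopologicalSpace G] [IsTopologicalGroup G] [CompactSpace G]
  [MeasurableSpace G] [BorelSpace G] {N : ℕ} (ρ : G →* Matrix (Fin N) (Fin N) ℂ)

/-- **Cauchy–Schwarz for the form `B_s(X,Y) = ∫ conj X(ΘŨ) Y(τˢŨ)` from Hermitian symmetry on the pair `(X, Y)`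
and positivity of `Re B_s(X + cY, X + cY)` for every complex `c`**: `‖B_s(X,Y)‖² ≤ Re B_s(X,X) · Re B_s(Y,Y)`.
[folklore] -/
theorem csclRP_cs_of_herm (hρ : Continuous ρ) (β : ℝ) {L : ℕ} [NeZero L] {X Y : LGConfig 4 G → ℂ}
    (hXm : Measurable X) (hYm : Measurable Y) (hXb : ∃ C : ℝ, ∀ U, ‖X U‖ ≤ C) (hYb : ∃ C : ℝ, ∀ U, ‖Y U‖ ≤ C)
    (s : ℤ)
    (hherm : ∫ U, conj (Y (gaugeTimeReflect (torusLift L U))) * X (configShift (-(Pi.single 0 s)) (torusLift L U))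
        ∂(wilsonMeasure (d := 4) (L := L) ρ β) =
      conj (∫ U, conj (X (gaugeTimeReflect (torusLift L U))) * Y (configShift (-(Pi.single 0 s)) (torusLift L U))
        ∂(wilsonMeasure (d := 4) (L := L) ρ β)))
    (hpos : ∀ c : ℂ, 0 ≤ (∫ U, conj (X (gaugeTimeReflect (torusLift L U)) + c * Y (gaugeTimeReflect (torusLift L U))) *
        (X (configShift (-(Pi.single 0 s)) (torusLift L U)) + c * Y (configShift (-(Pi.single 0 s)) (torusLift L U)))
        ∂(wilsonMeasure (d := 4) (L := L) ρ β)).re) :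
    ‖∫ U, conj (X (gaugeTimeReflect (torusLift L U))) * Y (configShift (-(Pi.single 0 s)) (torusLift L U))
        ∂(wilsonMeasure (d := 4) (L := L) ρ β)‖ ^ 2 ≤
      (∫ U, conj (X (gaugeTimeReflect (torusLift L U))) * X (configShift (-(Pi.single 0 s)) (torusLift L U))
          ∂(wilsonMeasure (d := 4) (L := L) ρ β)).re *
        (∫ U, conj (Y (gaugeTimeReflect (torusLift L U))) * Y (configShift (-(Pi.single 0 s)) (torusLift L U))
          ∂(wilsonMeasure (d := 4) (L := L) ρ β)).re := by
  refine cscl_cs_of_psd _ _ _ fun c => ?_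
  have h := hpos c
  rw [cscl_form_expand ρ hρ β hXm hYm hXb hYb c s, hherm, csclRP_re_expand] at h
  exact h

omit [Group G] [TopologicalSpace G] [IsTopologicalGroup G] [CompactSpace G] [BorelSpace G] in
/-- Bounded measurable data of the combination `X + cY`. [folklore] -/
theorem csclRP_comb {X Y : LGConfig 4 G → ℂ} (hXm : Measurable X) (hYm : Measurable Y)
    (hXb : ∃ C : ℝ, ∀ U, ‖X U‖ ≤ C) (hYb : ∃ C : ℝ, ∀ U, ‖Y U‖ ≤ C) (c : ℂ) :
    Measurable (fun V => X V + c * Y V) ∧ ∃ C : ℝ, ∀ V, ‖X V + c * Y V‖ ≤ C := by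
  obtain ⟨CX, hCX⟩ := hXb
  obtain ⟨CY, hCY⟩ := hYb
  refine ⟨hXm.add (hYm.const_mul c), CX + ‖c‖ * CY, fun V => (norm_add_le _ _).trans (add_le_add (hCX V) ?_)⟩
  rw [norm_mul]
  exact mul_le_mul_of_nonneg_left (hCY V) (norm_nonneg c)

variable {S : ℕ}

/-- **The site form `Q₁(X,Y) = ∫ conj X(ΘŨ) Y(τŨ)` is a positive Hermitian form** on bounded measurable cylinder
observables supported at times `0 ≤ x₀ ≤ S - 2` of the torus of side `2S+1` (`β ≥ 0`): the diagonal is real and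
non-negative (`torus_rp_site`, `cscl_site_herm`) and Cauchy–Schwarz holds. [folklore] -/
theorem csclRP_site (hρ : Continuous ρ) {β : ℝ} (hβ : 0 ≤ β) {X Y : LGConfig 4 G → ℂ}
    (hXm : Measurable X) (hYm : Measurable Y) (hXb : ∃ C : ℝ, ∀ U, ‖X U‖ ≤ C) (hYb : ∃ C : ℝ, ∀ U, ‖Y U‖ ≤ C)
    {ΛX ΛY : Finset (Literature.MathematicalPhysics.QuantumLattice.ZdEdge 4)}
    (hXc : IsCylinder X ΛX) (hYc : IsCylinder Y ΛY)
    (hΛX : (↑ΛX : Set (Literature.MathematicalPhysics.QuantumLattice.ZdEdge 4)) ⊆ posTimeEdges)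
    (hΛY : (↑ΛY : Set (Literature.MathematicalPhysics.QuantumLattice.ZdEdge 4)) ⊆ posTimeEdges)
    (hSX : maxTime ΛX + 2 ≤ S) (hSY : maxTime ΛY + 2 ≤ S) :
    (∫ U, conj (X (gaugeTimeReflect (torusLift (2 * S + 1) U))) *
        X (configShift (-(Pi.single 0 1)) (torusLift (2 * S + 1) U)) ∂(wilsonMeasure (d := 4) (L := 2 * S + 1) ρ β)).im = 0 ∧
    0 ≤ (∫ U, conj (X (gaugeTimeReflect (torusLift (2 * S + 1) U))) *
        X (configShift (-(Pi.single 0 1)) (torusLift (2 * S + 1) U)) ∂(wilsonMeasure (d := 4) (L := 2 * S + 1) ρ β)).re ∧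
    ‖∫ U, conj (X (gaugeTimeReflect (torusLift (2 * S + 1) U))) *
        Y (configShift (-(Pi.single 0 1)) (torusLift (2 * S + 1) U)) ∂(wilsonMeasure (d := 4) (L := 2 * S + 1) ρ β)‖ ^ 2 ≤
      (∫ U, conj (X (gaugeTimeReflect (torusLift (2 * S + 1) U))) *
          X (configShift (-(Pi.single 0 1)) (torusLift (2 * S + 1) U)) ∂(wilsonMeasure (d := 4) (L := 2 * S + 1) ρ β)).re *
        (∫ U, conj (Y (gaugeTimeReflect (torusLift (2 * S + 1) U))) *
          Y (configShift (-(Pi.single 0 1)) (torusLift (2 * S + 1) U)) ∂(wilsonMeasure (d := 4) (L := 2 * S + 1) ρ β)).re := by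
  have hΛ : (↑(ΛX ∪ ΛY) : Set (Literature.MathematicalPhysics.QuantumLattice.ZdEdge 4)) ⊆ posTimeEdges := by
    rw [Finset.coe_union]
    exact Set.union_subset hΛX hΛY
  have hS : maxTime (ΛX ∪ ΛY) + 2 ≤ S := by
    rw [cscl_maxTime_union]
    omega
  refine ⟨Complex.conj_eq_iff_im.1 (cscl_site_herm ρ hρ β _ X X).symm,
    torus_rp_site ρ hρ hβ hXm hXb hXc hΛX hSX,
    csclRP_cs_of_herm ρ hρ β hXm hYm hXb hYb 1 (cscl_site_herm ρ hρ β _ X Y) fun c => ?_⟩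
  obtain ⟨hFm, hFb⟩ := csclRP_comb hXm hYm hXb hYb c
  exact torus_rp_site ρ hρ hβ hFm hFb (cscl_isCylinder_add_smul hXc hYc c) hΛ hS

/-- **The bond form `Q₀(X,Y) = ∫ conj X(ΘŨ) Y(Ũ)` is a positive Hermitian form** on bounded measurable cylinder
observables supported at times `0 ≤ x₀ ≤ S - 1` of the torus of side `2S+1` (`β ≥ 0`): the diagonal is real and
non-negative (`torus_rp_bond`, `cscl_bond_herm`) and Cauchy–Schwarz holds. [folklore] -/
theorem csclRP_bond (hρ : Continuous ρ) {β : ℝ} (hβ : 0 ≤ β) {X Y : LGConfig 4 G → ℂ}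
    (hXm : Measurable X) (hYm : Measurable Y) (hXb : ∃ C : ℝ, ∀ U, ‖X U‖ ≤ C) (hYb : ∃ C : ℝ, ∀ U, ‖Y U‖ ≤ C)
    {ΛX ΛY : Finset (Literature.MathematicalPhysics.QuantumLattice.ZdEdge 4)}
    (hXc : IsCylinder X ΛX) (hYc : IsCylinder Y ΛY)
    (hΛX : (↑ΛX : Set (Literature.MathematicalPhysics.QuantumLattice.ZdEdge 4)) ⊆ posTimeEdges)
    (hΛY : (↑ΛY : Set (Literature.MathematicalPhysics.QuantumLattice.ZdEdge 4)) ⊆ posTimeEdges)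
    (hSX : maxTime ΛX + 1 ≤ S) (hSY : maxTime ΛY + 1 ≤ S) :
    (∫ U, conj (X (gaugeTimeReflect (torusLift (2 * S + 1) U))) * X (torusLift (2 * S + 1) U)
        ∂(wilsonMeasure (d := 4) (L := 2 * S + 1) ρ β)).im = 0 ∧
    0 ≤ (∫ U, conj (X (gaugeTimeReflect (torusLift (2 * S + 1) U))) * X (torusLift (2 * S + 1) U)
        ∂(wilsonMeasure (d := 4) (L := 2 * S + 1) ρ β)).re ∧
    ‖∫ U, conj (X (gaugeTimeReflect (torusLift (2 * S + 1) U))) * Y (torusLift (2 * S + 1) U)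
        ∂(wilsonMeasure (d := 4) (L := 2 * S + 1) ρ β)‖ ^ 2 ≤
      (∫ U, conj (X (gaugeTimeReflect (torusLift (2 * S + 1) U))) * X (torusLift (2 * S + 1) U)
          ∂(wilsonMeasure (d := 4) (L := 2 * S + 1) ρ β)).re *
        (∫ U, conj (Y (gaugeTimeReflect (torusLift (2 * S + 1) U))) * Y (torusLift (2 * S + 1) U)
          ∂(wilsonMeasure (d := 4) (L := 2 * S + 1) ρ β)).re := by
  have hS1 : 1 ≤ S := by omega
  have hΛ : (↑(ΛX ∪ ΛY) : Set (Literature.MathematicalPhysics.QuantumLattice.ZdEdge 4)) ⊆ posTimeEdges := by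
    rw [Finset.coe_union]
    exact Set.union_subset hΛX hΛY
  have hS : maxTime (ΛX ∪ ΛY) + 1 ≤ S := by
    rw [cscl_maxTime_union]
    omega
  have hτ0 : ∀ W : LGConfig 4 G, configShift (-(Pi.single (0 : Fin 4) (0 : ℤ))) W = W := fun W => by
    rw [Pi.single_zero, neg_zero]
    exact rpShift_configShift_zero W
  refine ⟨Complex.conj_eq_iff_im.1 (cscl_bond_herm ρ hρ β _ X X).symm,
    torus_rp_bond ρ hρ hβ hS1 hXm hXb hXc hΛX hSX, ?_⟩
  have h := csclRP_cs_of_herm ρ hρ β hXm hYm hXb hYb 0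
    (by simpa only [hτ0] using cscl_bond_herm ρ hρ β (2 * S + 1) X Y) fun c => by
      obtain ⟨hFm, hFb⟩ := csclRP_comb hXm hYm hXb hYb c
      simpa only [hτ0] using torus_rp_bond ρ hρ hβ hS1 hFm hFb (cscl_isCylinder_add_smul hXc hYc c) hΛ hS
  simpa only [hτ0] using h

/-! ### The dictionary: shifted observables and the pairing `𝒫_σ` -/

omit [Group G] [TopologicalSpace G] [IsTopologicalGroup G] [CompactSpace G] [BorelSpace G] in
/-- **Time translates of positive-time observables.** For `X` bounded measurable and cylinder on links based at times
`1 ≤ x₀ ≤ v`, the translate `X ∘ τ^{k-1}` is bounded measurable and cylinder on the translated links, based at times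
`k ≤ x₀ ≤ v + k - 1` (so inside `posTimeEdges`, with `maxTime ≤ v + k - 1`). [folklore] -/
theorem csclRP_shift_obs {X : LGConfig 4 G → ℂ} (hXm : Measurable X) (hXb : ∃ C : ℝ, ∀ V, ‖X V‖ ≤ C)
    {Λ : Finset (Literature.MathematicalPhysics.QuantumLattice.ZdEdge 4)} (hXc : IsCylinder X Λ) {v : ℕ}
    (hΛ : ∀ e ∈ Λ, 1 ≤ e.1 0 ∧ e.1 0 ≤ (v : ℤ)) (k : ℕ) :
    Measurable (fun V => X (configShift (-(Pi.single 0 ((k : ℤ) - 1))) V)) ∧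
    (∃ C : ℝ, ∀ V, ‖X (configShift (-(Pi.single 0 ((k : ℤ) - 1))) V)‖ ≤ C) ∧
    IsCylinder (fun V => X (configShift (-(Pi.single 0 ((k : ℤ) - 1))) V))
      (Λ.image fun e => (e.1 + Pi.single 0 ((k : ℤ) - 1), e.2)) ∧
    (↑(Λ.image fun e => (e.1 + Pi.single 0 ((k : ℤ) - 1), e.2)) :
        Set (Literature.MathematicalPhysics.QuantumLattice.ZdEdge 4)) ⊆ posTimeEdges ∧
    maxTime (Λ.image fun e => (e.1 + Pi.single 0 ((k : ℤ) - 1), e.2)) ≤ v + k - 1 := by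
  obtain ⟨C, hC⟩ := hXb
  have hmem : ∀ e : Literature.MathematicalPhysics.QuantumLattice.ZdEdge 4,
      e ∈ Λ.image (fun e => (e.1 + Pi.single 0 ((k : ℤ) - 1), e.2)) →
      (k : ℤ) ≤ e.1 0 ∧ e.1 0 ≤ (v : ℤ) + k - 1 := by
    intro e he
    obtain ⟨e', he', rfl⟩ := Finset.mem_image.1 he
    have h := hΛ e' he'
    simp only [Pi.add_apply, Pi.single_eq_same]
    omega
  refine ⟨hXm.comp (Literature.MathematicalPhysics.QuantumLattice.configShift _).measurable, ⟨C, fun V => hC _⟩,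
    obsGeometry_isCylinder_comp_configShift _ hXc,
    fun e he => mem_posTimeEdges.2 ?_, Finset.sup_le fun e he => ?_⟩
  · have h := (hmem e (Finset.mem_coe.1 he)).1
    omega
  · have h := hmem e he
    omega

/-- **Dictionary, site form**: `𝒫_σ(X,Y) = ∫ conj X(τ^{k-1}ΘŨ) · Y(τ^{l-1}τŨ)` (`= B_1(X∘τ^{k-1}, Y∘τ^{l-1})`) whenever
`k + l = σ` (`cscl_site_pairing_eq`, `cscl_shift_pair`). [folklore] -/
theorem csclRP_dict_site (β : ℝ) (L : ℕ) [NeZero L] (X Y : LGConfig 4 G → ℂ) {σ k l : ℕ} (h : k + l = σ) :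
    ∫ U, conj (X (cfgReflect (torusLift L U))) * Y (configShift (-(Pi.single 0 (σ : ℤ))) (torusLift L U))
        ∂(wilsonMeasure (d := 4) (L := L) ρ β) =
      ∫ U, conj (X (configShift (-(Pi.single 0 ((k : ℤ) - 1))) (gaugeTimeReflect (torusLift L U)))) *
        Y (configShift (-(Pi.single 0 ((l : ℤ) - 1))) (configShift (-(Pi.single 0 1)) (torusLift L U)))
        ∂(wilsonMeasure (d := 4) (L := L) ρ β) := by
  rw [cscl_site_pairing_eq]
  simp_rw [rpShift_configShift_configShift]
  rw [cscl_shift_pair]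
  have e : (-1 + (σ : ℤ)) = (k : ℤ) - 1 + (1 + ((l : ℤ) - 1)) := by omega
  rw [e]

/-- **Dictionary, bond form**: `𝒫_σ(X,Y) = ∫ conj X(τ^{k-1}ΘŨ) · Y(τ^{l-1}Ũ)` (`= B_0(X∘τ^{k-1}, Y∘τ^{l-1})`) whenever
`k + l = σ + 1` (`cscl_site_pairing_eq`, `cscl_shift_pair`). [folklore] -/
theorem csclRP_dict_bond (β : ℝ) (L : ℕ) [NeZero L] (X Y : LGConfig 4 G → ℂ) {σ k l : ℕ} (h : k + l = σ + 1) :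
    ∫ U, conj (X (cfgReflect (torusLift L U))) * Y (configShift (-(Pi.single 0 (σ : ℤ))) (torusLift L U))
        ∂(wilsonMeasure (d := 4) (L := L) ρ β) =
      ∫ U, conj (X (configShift (-(Pi.single 0 ((k : ℤ) - 1))) (gaugeTimeReflect (torusLift L U)))) *
        Y (configShift (-(Pi.single 0 ((l : ℤ) - 1))) (torusLift L U))
        ∂(wilsonMeasure (d := 4) (L := L) ρ β) := by
  rw [cscl_site_pairing_eq, cscl_shift_pair]
  have e : (-1 + (σ : ℤ)) = (k : ℤ) - 1 + ((l : ℤ) - 1) := by omega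
  rw [e]

end Forms

/-! ### The registered stub -/

/-- `stub_csclTorusRP` — **the complex two-form reflection-positivity package of the odd torus** (line `Sketch`,
reshape 18, of crux stmt-QuantumFields-15828). With `Ũ = torusLift (2S+1) U`, `τ^σ = configShift (−σ e₀)` and
`𝒫_σ(X,Y) = ∫ conj X(cfgReflect Ũ) · Y(τ^σ Ũ) dμ_{2S+1,β}`, for bounded measurable complex cylinder observables `X, Y`
of the `ℤ⁴` gauge field supported on links based at times `1 ≤ x₀ ≤ v` and `β ≥ 0`:
(a) `𝒫_σ(X,X)` is real and `≥ 0` for `v + σ + 2 ≤ S`; (b) `‖𝒫_{σ+1}(X,X)‖² ≤ Re 𝒫_σ(X,X) · Re 𝒫_{σ+2}(X,X)` for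
`v + σ + 3 ≤ S` (log-convexity); (c) `‖𝒫_{a+c}(X,Y)‖² ≤ Re 𝒫_{2a}(X,X) · Re 𝒫_{2c}(Y,Y)` for `v + a + c + 2 ≤ S`.
Proof: `𝒫_σ = B_{σ-1}` is a value of the site form (`σ` even) or of the bond form (`σ` odd) of Osterwalder–Seiler
reflection positivity on suitably time-translated observables (`csclRP_dict_site`, `csclRP_dict_bond`), and both forms
are positive Hermitian, hence Cauchy–Schwarz (`csclRP_site`, `csclRP_bond`, from the tree's `torus_rp_site` /
`torus_rp_bond`). [folklore] -/
theorem stub_csclTorusRP :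
    ∀ (G : Type) [Group G] [TopologicalSpace G] [IsTopologicalGroup G] [CompactSpace G]
      [MeasurableSpace G] [BorelSpace G] (r : LatticeRep G) (β : ℝ), 0 ≤ β → ∀ (S v : ℕ)
      (X Y : LGConfig 4 G → ℂ) (ΛX ΛY : Finset (Literature.MathematicalPhysics.QuantumLattice.ZdEdge 4)),
      Measurable X → Measurable Y → (∃ C : ℝ, ∀ V, ‖X V‖ ≤ C) → (∃ C : ℝ, ∀ V, ‖Y V‖ ≤ C) →
      IsCylinder X ΛX → IsCylinder Y ΛY →
      (∀ e ∈ ΛX, 1 ≤ e.1 0 ∧ e.1 0 ≤ (v : ℤ)) → (∀ e ∈ ΛY, 1 ≤ e.1 0 ∧ e.1 0 ≤ (v : ℤ)) →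
      (∀ σ : ℕ, v + σ + 2 ≤ S →
        (∫ U : GaugeConfig 4 (2 * S + 1) G, (starRingEnd ℂ) (X (cfgReflect (torusLift (2 * S + 1) U))) * X (configShift (-(Pi.single 0 ((σ : ℕ) : ℤ))) (torusLift (2 * S + 1) U)) ∂(wilsonMeasure r.ρ β)).im = 0 ∧
        0 ≤ (∫ U : GaugeConfig 4 (2 * S + 1) G, (starRingEnd ℂ) (X (cfgReflect (torusLift (2 * S + 1) U))) * X (configShift (-(Pi.single 0 ((σ : ℕ) : ℤ))) (torusLift (2 * S + 1) U)) ∂(wilsonMeasure r.ρ β)).re) ∧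
      (∀ σ : ℕ, v + σ + 3 ≤ S →
        ‖∫ U : GaugeConfig 4 (2 * S + 1) G, (starRingEnd ℂ) (X (cfgReflect (torusLift (2 * S + 1) U))) * X (configShift (-(Pi.single 0 ((σ + 1 : ℕ) : ℤ))) (torusLift (2 * S + 1) U)) ∂(wilsonMeasure r.ρ β)‖ ^ 2 ≤
          (∫ U : GaugeConfig 4 (2 * S + 1) G, (starRingEnd ℂ) (X (cfgReflect (torusLift (2 * S + 1) U))) * X (configShift (-(Pi.single 0 ((σ : ℕ) : ℤ))) (torusLift (2 * S + 1) U)) ∂(wilsonMeasure r.ρ β)).re *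
          (∫ U : GaugeConfig 4 (2 * S + 1) G, (starRingEnd ℂ) (X (cfgReflect (torusLift (2 * S + 1) U))) * X (configShift (-(Pi.single 0 ((σ + 2 : ℕ) : ℤ))) (torusLift (2 * S + 1) U)) ∂(wilsonMeasure r.ρ β)).re) ∧
      (∀ a c : ℕ, v + a + c + 2 ≤ S →
        ‖∫ U : GaugeConfig 4 (2 * S + 1) G, (starRingEnd ℂ) (X (cfgReflect (torusLift (2 * S + 1) U))) * Y (configShift (-(Pi.single 0 ((a + c : ℕ) : ℤ))) (torusLift (2 * S + 1) U)) ∂(wilsonMeasure r.ρ β)‖ ^ 2 ≤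
          (∫ U : GaugeConfig 4 (2 * S + 1) G, (starRingEnd ℂ) (X (cfgReflect (torusLift (2 * S + 1) U))) * X (configShift (-(Pi.single 0 ((2 * a : ℕ) : ℤ))) (torusLift (2 * S + 1) U)) ∂(wilsonMeasure r.ρ β)).re *
          (∫ U : GaugeConfig 4 (2 * S + 1) G, (starRingEnd ℂ) (Y (cfgReflect (torusLift (2 * S + 1) U))) * Y (configShift (-(Pi.single 0 ((2 * c : ℕ) : ℤ))) (torusLift (2 * S + 1) U)) ∂(wilsonMeasure r.ρ β)).re) := by
  intro G _ _ _ _ _ _ r β hβ S v X Y ΛX ΛY hXm hYm hXb hYb hXc hYc hΛX hΛY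
  refine ⟨fun σ hσ => ?_, fun σ hσ => ?_, fun a c hac => ?_⟩
  · obtain ⟨a, ha | ha⟩ := Nat.even_or_odd' σ
    · -- `σ = 2a`: `𝒫_σ(X,X) = Q₁(X∘τ^{a-1}, X∘τ^{a-1})`
      obtain ⟨m, b, cy, pos, mt⟩ := csclRP_shift_obs hXm hXb hXc hΛX a
      have h := csclRP_site r.ρ r.continuous hβ (S := S) m m b b cy cy pos pos (by omega) (by omega)
      rw [csclRP_dict_site r.ρ β (2 * S + 1) X X (show a + a = σ by omega)]
      exact ⟨h.1, h.2.1⟩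
    · -- `σ = 2a+1`: `𝒫_σ(X,X) = Q₀(X∘τ^a, X∘τ^a)`
      obtain ⟨m, b, cy, pos, mt⟩ := csclRP_shift_obs hXm hXb hXc hΛX (a + 1)
      have h := csclRP_bond r.ρ r.continuous hβ (S := S) m m b b cy cy pos pos (by omega) (by omega)
      rw [csclRP_dict_bond r.ρ β (2 * S + 1) X X (show (a + 1) + (a + 1) = σ + 1 by omega)]
      exact ⟨h.1, h.2.1⟩
  · obtain ⟨a, ha | ha⟩ := Nat.even_or_odd' σ
    · -- `σ = 2a`: `𝒫_{σ+1}(X,X) = Q₁(X∘τ^{a-1}, X∘τ^a)`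
      obtain ⟨m₁, b₁, cy₁, pos₁, mt₁⟩ := csclRP_shift_obs hXm hXb hXc hΛX a
      obtain ⟨m₂, b₂, cy₂, pos₂, mt₂⟩ := csclRP_shift_obs hXm hXb hXc hΛX (a + 1)
      have h := csclRP_site r.ρ r.continuous hβ (S := S) m₁ m₂ b₁ b₂ cy₁ cy₂ pos₁ pos₂ (by omega) (by omega)
      rw [csclRP_dict_site r.ρ β (2 * S + 1) X X (show a + (a + 1) = σ + 1 by omega),
        csclRP_dict_site r.ρ β (2 * S + 1) X X (show a + a = σ by omega),
        csclRP_dict_site r.ρ β (2 * S + 1) X X (show (a + 1) + (a + 1) = σ + 2 by omega)]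
      exact h.2.2
    · -- `σ = 2a+1`: `𝒫_{σ+1}(X,X) = Q₀(X∘τ^a, X∘τ^{a+1})`
      obtain ⟨m₁, b₁, cy₁, pos₁, mt₁⟩ := csclRP_shift_obs hXm hXb hXc hΛX (a + 1)
      obtain ⟨m₂, b₂, cy₂, pos₂, mt₂⟩ := csclRP_shift_obs hXm hXb hXc hΛX (a + 2)
      have h := csclRP_bond r.ρ r.continuous hβ (S := S) m₁ m₂ b₁ b₂ cy₁ cy₂ pos₁ pos₂ (by omega) (by omega)
      rw [csclRP_dict_bond r.ρ β (2 * S + 1) X X (show (a + 1) + (a + 2) = σ + 1 + 1 by omega),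
        csclRP_dict_bond r.ρ β (2 * S + 1) X X (show (a + 1) + (a + 1) = σ + 1 by omega),
        csclRP_dict_bond r.ρ β (2 * S + 1) X X (show (a + 2) + (a + 2) = σ + 2 + 1 by omega)]
      exact h.2.2
  · -- `𝒫_{a+c}(X,Y) = Q₁(X∘τ^{a-1}, Y∘τ^{c-1})`
    obtain ⟨m₁, b₁, cy₁, pos₁, mt₁⟩ := csclRP_shift_obs hXm hXb hXc hΛX a
    obtain ⟨m₂, b₂, cy₂, pos₂, mt₂⟩ := csclRP_shift_obs hYm hYb hYc hΛY c
    have h := csclRP_site r.ρ r.continuous hβ (S := S) m₁ m₂ b₁ b₂ cy₁ cy₂ pos₁ pos₂ (by omega) (by omega)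
    rw [csclRP_dict_site r.ρ β (2 * S + 1) X Y (show a + c = a + c from rfl),
      csclRP_dict_site r.ρ β (2 * S + 1) X X (show a + a = 2 * a by omega),
      csclRP_dict_site r.ρ β (2 * S + 1) Y Y (show c + c = 2 * c by omega)]
    exact h.2.2

end Summit.QuantumFields.YangMills.Theorems.ContinuumLegGivenGap

end
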